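import Mathlib
import HarnessLib
import Summits.HubbardSuperconductivity.HubbardSuperconductivity.Theorems.KLProgrammeKLRegimeEngineTowerLevLawFOfBlocksZX
import Summits.HubbardSuperconductivity.HubbardSuperconductivity.Theorems.KLProgrammeKLRegimeEngineTowerLevReadoutFitFBorn
import Summits.HubbardSuperconductivity.HubbardSuperconductivity.Theorems.KLProgrammeKLRegimeKernelNormsLevelsFloorTracks

/-!
# Route `KLProgramme` — crux K3 ENGINE (stmt-HubbardSuperconductivity-20437), stub (b) v2, THE LEVELS PACKAGE (ℓ), read-out (I6)/(I7): «(ℓ)-READOUT-F» piece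
# RO-5, THE PER-LEVEL CLOSER (born form, closer″) — `KernelNormsLevels` AT A READ-OUT LEVEL `j` OF BLOCK `Kb` from the floor-keyed law with exports, the floor read-out and the
# floor tracks (cell gate-hubbard-kl, seat p4 g20; `…TowerLevLawFOfBlocksZX.klTowerBLevF_le_law_lev_of_blocks_ZX` (this seat) ∘
# `…TowerLevReadoutFitFBorn.readoutLevF_le_levelsRHS_of_bornRows` (k3c3-p2 g16, RO-4‴) ∘ `…KernelNormsLevelsFloorTracks.kernelNormsLevels_of_floorTracks` (this seat))

For a read-out level `j` inside the block `Kb ≥ 1` (`d·Kb ≤ j ≤ n_β + 1`; every level of every block `Kb ≥ 1`) the registered clause `KernelNormsLevels L M P Qe β U μ K j` follows from: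
the binder list of the law `klTowerBLevF_le_law_lev_of_blocks_ZX` (base weighted grid step at `(Λ_d, F_{d−1})`, derived constants, E1's numerics `ι₂ X ι₁`, the
per-block link data, the six pinned names, blocking, `B ≥ B₀`, the two doors) with the imports `ι₁, ι₂` asked up to the read-out block `k ≤ Kb`; k3c2-p3's
partial-block step BORN at `F_{dKb}` (RO-2: the tail of `partialIncrLevF_le_kitStep_of_bounds` / `_klEng` verbatim — the hypothesis of RO-4‴); the read-out constants `Aro Qro Qtot Atot` (equational) and the threshold
`Qtot·ε_x²·B·max 1 (Atot/ε_x) ≤ Qe.CE`; the degree cap `card (HubbardFieldIdx L M) ≤ 2D + 1`; and the six-leg one-level cell clause at level `j`.  Inside: the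
law yields the block law on `2 ≤ k′ ≤ Kb`, the Chernoff rows of block `Kb`, the smallness rows and `Z ≠ 0`; the base datum `N_b` is rebuilt from the grid step as
the assembly does (`klWtPinnedSumAt_klEffectiveAction_fam_le_of_wgridStep`, `wgridBudget_bigraded_le`, `baseRowsF_of_wgrid_bigraded`); RO-4‴ (jump `dKb → j` absorbed in `Cinc, Dinc`) gives the clause on
every floor track with `7 ≤ 2p + t`; «(ℓ)-RO5-FLOOR-TRACKS» closes on `t = 0, 2, 4` plus the cell `(p,t) = (3,0)`, capped at `D` by nilpotency.
What remains hypothetical, by owner: base grid-step rows (p3/E1), E1's imports/cell/`B ≥ B₀`/blocking, per-block link data (discharged on the flow frame by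
`linkDataF_klEng`), the doors, `hinc` (RO-2, k3c2-p3), the six-leg cell at level `j` (E1), the CE threshold (closer's choice of `Qe.CE`); levels `j < d` (block 0) are RO-3.

Composition of landed theorems only; nothing about the model is asserted beyond them; nothing asserts (ℓ), any stub, K3 or superconductivity.
References: BGM 2006 §2.8 (2.76)–(2.84), (2.93)–(2.98), Lemma 2.5, §3 (3.2)–(3.8) [cite: BenfattoGiulianiMastropietro2006].
-/

noncomputable section

namespace Summit.HubbardSuperconductivity.HubbardSuperconductivity.Theorems.EngineV8

set_option linter.dupNamespace false -- summit = problem name (single-conjunct summit), D-0017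

open Classical
open Real Finset Literature.MathematicalPhysics.QuantumLattice Literature.Probability.LatticeModels GrassmannAlgebra
open Literature.Probability.LatticeModels.BattleFederbush
open Literature.MathematicalPhysics.QuantumLattice.FermiRG
open Summit.HubbardSuperconductivity.HubbardSuperconductivity.Theorems.KLProgrammeLegKernels
open Summit.HubbardSuperconductivity.HubbardSuperconductivity.Theorems.KLRegimeSplit
open Summit.HubbardSuperconductivity.HubbardSuperconductivity.Theorems.KLRegimeWick
open Summit.HubbardSuperconductivity.HubbardSuperconductivity.Theorems.TorusFourierL2
open Summit.HubbardSuperconductivity.HubbardSuperconductivity.Theorems.DispersionFlow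

variable {L M : ℕ} [NeZero L] [NeZero M]

set_option maxHeartbeats 400000 in -- two ~150-binder compositions + the base datum in one declaration
/-- **`KernelNormsLevels` AT A READ-OUT LEVEL OF A BLOCK, FROM THE FLOOR-KEYED LAW, THE FLOOR READ-OUT AND THE FLOOR TRACKS** («(ℓ)-READOUT-F» RO-5,
the per-level closer, born form — `hinc` dischargeable by k3c2-p3's (d′)/(e′)): see the module docstring for the binder list; conclusion `KernelNormsLevels L M P Qe β U μ K j`.
[cite: BenfattoGiulianiMastropietro2006, §2.8 (2.76)-(2.84), Lemma 2.5 (2.98), §3 (3.2)-(3.8)] -/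
theorem kernelNormsLevels_readoutF_of_blocks_born :
    ∃ C₁ C₂ C₁' C₂' Cinc Dinc : ℝ, 0 < C₁ ∧ 0 < C₂ ∧ 0 < C₁' ∧ 0 < C₂' ∧ 0 < Cinc ∧ 1 ≤ Dinc ∧
    ∀ R : RenConsts, R.WF2 → ∃ c₃' : ℝ, 0 < c₃' ∧ ∃ U₀' : ℝ, 0 < U₀' ∧
      ∀ (P : SplitConsts) (c : ℝ), P.WF → 0 < c → c ≤ klEngC₃6 P R → c ≤ c₃' →
      ∀ μ ∈ klWindowC, ∀ U : ℝ, 0 < U → U ≤ klEngU₀9 P R c → U ≤ U₀' → ∀ β : ℝ, klBetaMin ≤ β → β ≤ Real.exp (c / U ^ 2) →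
      ∀ K : TrigPolyC4v, FrameOK R U (nScales β) μ K → ∀ (L M : ℕ) [NeZero L] [NeZero M],
      klEngL₃ β U ≤ L → klEngM₃ β U L ≤ M → ∀ d Kb D : ℕ, 2 ≤ d → d * Kb - 1 ≤ nScales β + 1 → 3 ≤ D →
      ∀ (cc : ℝ) (n j : ℕ), IsKLRegime U cc (-(n : ℤ)) → j ≤ n →
      -- the read-out level `j` inside the block `Kb ≥ 1` («(ℓ)-READOUT-F»)
      1 ≤ Kb → d * Kb ≤ j → j ≤ nScales β + 1 →
      ∀ (B : ℝ), 1 ≤ B →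
      -- p3's weighted grid step hypotheses at the cutoff `Λ_d`, analysis family `F_{d−1}`, rate `jw`
      ∀ (jw : ℕ) (κ : ℝ), 0 < κ →
        IsGramBoundedR ((hubbardGridSub L M β (2 * (2 * M))).transpose * hubbardCovAboveCT L M β μ 0 K (klScale klE0 d) *
          hubbardGridSub L M β (2 * (2 * M))) κ →
      ∀ (αw : ℝ), 0 < αw →
        (∀ X, ∑ Y, ‖((hubbardGridSub L M β (2 * (2 * M))).transpose * hubbardCovAboveCT L M β μ 0 K (klScale klE0 d) *
          hubbardGridSub L M β (2 * (2 * M))) X Y‖ * gridLabelWt L (2 * (2 * M)) β {gridLegPos X, gridLegPos Y} ≤ αw) →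
        (∀ Y, ∑ X, ‖((hubbardGridSub L M β (2 * (2 * M))).transpose * hubbardCovAboveCT L M β μ 0 K (klScale klE0 d) *
          hubbardGridSub L M β (2 * (2 * M))) X Y‖ * gridLabelWt L (2 * (2 * M)) β {gridLegPos X, gridLegPos Y} ≤ αw) →
      ∀ (ρ : ℝ), 0 < ρ →
        Real.exp 1 * αw * normV (GridLeg (GridPoint L (2 * (2 * M)))) κ ρ
          (fun m' : ℕ => if m' = 1 then |β| / (2 * (2 * M) : ℕ) * ∑ z : TorusSite 2 L, ‖framePosKernel L K z‖ * (1 + torusSiteDist z 0)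
            else if m' = 2 then |U| * |β| / (2 * (2 * M) : ℕ) else 0) / κ ^ 2 < 1 →
      ∀ (crw ccw : ℝ), 0 < crw → 0 < ccw →
        (∀ X'' : SpaceTimeIdx L M × SectorLeg (sectorCount (d - 1)), ∑ X' : GridLeg (GridPoint L (2 * (2 * M))),
          ‖(sectorAnalysisMatrix L M β (klAnisoFamily L M β μ K klE0 (d - 1)) * hubbardGridSub L M β (2 * (2 * M))) X'' X'‖ *
            gridLabelWt L (2 * (2 * M)) β {latticeLegPos (2 * (2 * M)) X'', gridLegPos X'} ≤ crw) →
        (∀ X' : GridLeg (GridPoint L (2 * (2 * M))), ∑ X'' : SpaceTimeIdx L M × SectorLeg (sectorCount (d - 1)),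
          ‖(sectorAnalysisMatrix L M β (klAnisoFamily L M β μ K klE0 (d - 1)) * hubbardGridSub L M β (2 * (2 * M))) X'' X'‖ *
            gridLabelWt L (2 * (2 * M)) β {latticeLegPos (2 * (2 * M)) X'', gridLegPos X'} ≤ ccw) →
      -- the derived base constants (equational binders)
      ∀ (nV cF cg Ag Pg : ℝ),
        nV = normV (GridLeg (GridPoint L (2 * (2 * M)))) κ ρ
          (fun m' : ℕ => if m' = 1 then |β| / (2 * (2 * M) : ℕ) * ∑ z : TorusSite 2 L, ‖framePosKernel L K z‖ * (1 + torusSiteDist z 0)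
            else if m' = 2 then |U| * |β| / (2 * (2 * M) : ℕ) else 0) →
        cF = (Real.exp 2 * (κ + ρ)) ^ (2 * 2) * (|β| / (2 * (2 * M) : ℕ)) → cg = Real.exp 1 * αw * cF / κ ^ 2 →
        Ag = crw * Real.exp 1 * cF / (ccw * cg ^ 2) → Pg = ccw ^ 2 * cg / (ρ ^ 2 * (1 - Real.exp 1 * αw * nV / κ ^ 2)) →
      ∀ (ι₂ X : ℝ), 0 ≤ ι₂ → 0 ≤ X →
      ∀ (Ab Qb Ab' ι₂' X' : ℝ), Ab = (2 : ℝ) ^ (7 * (d - 1)) * Ag / P.Klam ^ 2 → Qb = Pg / (8 : ℝ) ^ (d - 1) →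
        Ab' = Ab / B ^ 2 → ι₂' = ι₂ / B → X' = X / B ^ 2 →
      -- the floor LINK data («(ℓ)-LINK-UNIFORM-F», k3c2-p3 g14): per-block Gram, decay and analysis-overlap rows at k-free bounds (NO partition function)
      ∀ (κb αb crb ccb : ℝ), 0 < κb → 0 < αb → 0 < crb → 0 < ccb →
      ∀ (κl αl : ℕ → ℝ), (∀ k, 1 ≤ k → k < Kb → 0 < κl k) → (∀ k, 1 ≤ k → k < Kb → κl k ^ 2 * (8 : ℝ) ^ (d * k) ≤ κb ^ 2) →
      (∀ k, 1 ≤ k → k < Kb → αl k ≤ αb * (4 : ℝ) ^ (d * k)) →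
      (∀ k, 1 ≤ k → k < Kb → IsGramBoundedR ((sectorSubMatrix L M β (bgmFatMultiplier L M klE0 β (nambuXiCT L μ K) (d * k - 1))).transpose *
        hubbardCovSliceCT L M β μ 0 K (klScale klE0 (d * (k + 1))) (klScale klE0 (d * k)) *
          sectorSubMatrix L M β (bgmFatMultiplier L M klE0 β (nambuXiCT L μ K) (d * k - 1))) (κl k)) →
      (∀ k, 1 ≤ k → k < Kb → ∀ X, ∑ Y, ‖((sectorSubMatrix L M β (bgmFatMultiplier L M klE0 β (nambuXiCT L μ K) (d * k - 1))).transpose *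
        hubbardCovSliceCT L M β μ 0 K (klScale klE0 (d * (k + 1))) (klScale klE0 (d * k)) *
          sectorSubMatrix L M β (bgmFatMultiplier L M klE0 β (nambuXiCT L μ K) (d * k - 1))) X Y‖ ≤ αl k) →
      (∀ k, 1 ≤ k → k < Kb → ∀ Y, ∑ X, ‖((sectorSubMatrix L M β (bgmFatMultiplier L M klE0 β (nambuXiCT L μ K) (d * k - 1))).transpose *
        hubbardCovSliceCT L M β μ 0 K (klScale klE0 (d * (k + 1))) (klScale klE0 (d * k)) *
          sectorSubMatrix L M β (bgmFatMultiplier L M klE0 β (nambuXiCT L μ K) (d * k - 1))) X Y‖ ≤ αl k) →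
      (∀ k, 1 ≤ k → k < Kb → ∀ X'', ∑ X', ‖(sectorAnalysisMatrix L M β (klAnisoFamily L M β μ K klE0 (d * k)) *
        sectorSubMatrix L M β (bgmFatMultiplier L M klE0 β (nambuXiCT L μ K) (d * k - 1))) X'' X'‖ ≤ crb) →
      (∀ k, 1 ≤ k → k < Kb → ∀ X', ∑ X'', ‖(sectorAnalysisMatrix L M β (klAnisoFamily L M β μ K klE0 (d * k)) *
        sectorSubMatrix L M β (bgmFatMultiplier L M klE0 β (nambuXiCT L μ K) (d * k - 1))) X'' X'‖ ≤ ccb) →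
      (∀ k, 1 ≤ k → k < Kb → Fintype.card (SpaceTimeIdx L M × SectorLeg (sectorCount (d * k - 1))) / 2 ≤ D) →
      -- the law's six names PINNED by the link (equational binders), and the import `ι₁`
      ∀ (W Z σ Φ ψ τ ι₁ : ℝ), W = 64 * (27 : ℝ) ^ 4 * exp 2 * crb / ccb → Z = exp 4 * ccb ^ 2 * imagTimeWeight β M ^ 2 / 8 →
        σ = κb ^ 2 / (exp 4 * ccb ^ 2) → Φ = 9 * αb * ccb / ((27 : ℝ) ^ 5 * exp 1 * κb ^ 2 * crb) → ψ = exp 4 * ccb ^ 2 / κb ^ 2 →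
        τ = exp 2 * κb ^ 2 / ccb ^ 2 → 0 ≤ ι₁ →
      ∀ (ρk Q' Q κA Yb Y A A' ι₃ : ℝ), ρk = max 4 (2 * τ * ψ) → Q' = Z * Qb + 1 → Q = ρk * Q' →
        κA = W * ((27 : ℝ) ^ 5 * (C₁ / C₂) * (8 : ℝ) ^ (d - 1)) →
        Yb = ι₂ / (2 * Q') + W * Z ^ 3 * X / (4 * Q' ^ 2) + (W * (27 : ℝ) ^ 5 * Ab + κA * Ab) * Q' / 2 →
        Y = ι₂' / (2 * Q') + W * Z ^ 3 * X' / (4 * Q' ^ 2) + (W * (27 : ℝ) ^ 5 * Ab' + κA * Ab') * Q' / 2 →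
        A = 2 * Y * (1 - ((2 : ℝ) ^ d)⁻¹) / (κA * Q') →
        A' = (W * (27 : ℝ) ^ 5 * Ab' + κA * Ab') + 2 * Y / Q' → ι₃ = W * Z ^ 3 * X' + A' * Q' ^ 3 →
      max 1 Z * C₂ ^ 2 * max 4 (2 * τ * ψ) ≤ (2 : ℝ) ^ (d - 1) →
      max 1 (max (8 * Φ * τ * Yb) (128 * exp 1 * ψ ^ 3 * τ ^ 4 * Φ * κA * Yb / ((1 - ((2 : ℝ) ^ d)⁻¹) * ρk ^ 3))) ≤ B →
      (∀ k, 1 ≤ k → k ≤ Kb → W * Z ^ 1 * klTowerMuLevF L M β U μ K d k 1 ≤ ι₁ * (B * epsCoupling P U j)) →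
      (∀ k, 1 ≤ k → k ≤ Kb → W * Z ^ 2 * klTowerMuLevF L M β U μ K d k 2 ≤ ι₂' * (B * epsCoupling P U j)) →
      (∀ k, 2 ≤ k → k ≤ Kb → klTowerMuLevAtF L M β U μ K d 0 k 3 ≤ X' * (B * epsCoupling P U j) ^ 2) →
      U ≤ min 1 (min (1 / (8 * σ * Q' + 1)) (min (1 / (2 * exp 1 * τ * Q' + 1)) (min (1 / (4 * Φ * τ * ι₁ + 1))
        (min (1 / (2 * (Φ * (exp 1 * τ * ι₁ + (exp 1 * τ) ^ 2 * ι₂' + (exp 1 * τ) ^ 3 * ι₃ + A' * (exp 1 * τ * Q') ^ 2 / 2)) + 1))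
          (min (A * Q ^ 3 / (16 * σ * Q' * A' * (4 * Q') ^ 3 + A * Q ^ 3))
            (A * Q ^ 3 / (16 * exp 1 * ψ * (2 * τ * ψ * Q') ^ 2 * Φ * τ ^ 2 * ι₁ ^ 2 + A * Q ^ 3))))))) / (2 * B * P.Klam + 1) →
      cc ≤ min 1 (min (1 / (8 * σ * Q' + 1)) (min (1 / (2 * exp 1 * τ * Q' + 1)) (min (1 / (4 * Φ * τ * ι₁ + 1))
        (min (1 / (2 * (Φ * (exp 1 * τ * ι₁ + (exp 1 * τ) ^ 2 * ι₂' + (exp 1 * τ) ^ 3 * ι₃ + A' * (exp 1 * τ * Q') ^ 2 / 2)) + 1))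
          (min (A * Q ^ 3 / (16 * σ * Q' * A' * (4 * Q') ^ 3 + A * Q ^ 3))
            (A * Q ^ 3 / (16 * exp 1 * ψ * (2 * τ * ψ * Q') ^ 2 * Φ * τ ^ 2 * ι₁ ^ 2 + A * Q ^ 3))))))) * Real.log 4 / (2 * B * P.Klam + 1) →
      -- the partial-block step at `(Kb, j)` BORN AT `F_{dKb}` (the tail of k3c2-p3's `partialIncrLevF_le_kitStep_klEng`, verbatim shape)
      (∀ N : ℕ, 1 ≤ N → Φ * towerV D τ (fun m => W * Z ^ m * klTowerMuLevF L M β U μ K d Kb m) < 1 →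
        ∀ (t : Fin 5) (q : ℕ) (Ωe : Fin (2 * q + 1 + 1) → Option (SectorLeg (sectorCount (d * Kb)))), levelCount Ωe = (t : ℕ) + 1 →
        klLevNormOf L M β μ K (d * Kb) (2 * q + 1 + 1) (klEffectiveAction L M β U μ K klE0 j - klTowerInput L M β U μ K d Kb) Ωe /
            klLevUnitF β M t (q + 1) (d * Kb) ≤
          towerFO D σ (fun m => W * Z ^ m * klTowerMuLevF L M β U μ K d Kb m) (q + 1) +
            ∑ n' ∈ Icc 2 N, exp 1 * Φ ^ (n' - 1) * ψ ^ (q + 1) * towerS D τ (fun m => W * Z ^ m * klTowerMuLevF L M β U μ K d Kb m) n' (q + 1) +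
            ψ ^ (q + 1) * exp 1 * towerV D τ (fun m => W * Z ^ m * klTowerMuLevF L M β U μ K d Kb m) *
              (Φ * towerV D τ (fun m => W * Z ^ m * klTowerMuLevF L M β U μ K d Kb m)) ^ N /
              (1 - Φ * towerV D τ (fun m => W * Z ^ m * klTowerMuLevF L M β U μ K d Kb m))) →
      -- the read-out constants (equational binders), the public constant's threshold, the degree cap, the six-leg cell at level `j`
      ∀ (Aro Qro Qtot Atot : ℝ), Aro = (27 : ℝ) ^ 5 * (C₁' / C₂') * (Ab' + (8 : ℝ) ^ (d - 1) * (A / (1 - ((2 : ℝ) ^ d)⁻¹))) →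
        Qro = C₂' ^ 2 * max Qb (((2 : ℝ) ^ (d - 1))⁻¹ * max Q Qb) → Qtot = Dinc * max 1 (max Qro (max (4 * Q') (2 * τ * ψ * Q'))) →
        Atot = Aro + Cinc * (A' * (4 * σ * (B * epsCoupling P U j) * Q' / (1 - 4 * σ * (B * epsCoupling P U j) * Q')) +
          exp 1 * ψ * (τ * (ι₁ * (B * epsCoupling P U j) + ι₂' / (2 * Q') + ι₃ / (4 * Q' ^ 2) + A' * Q' / 4)) *
            (Φ * (τ * (ι₁ * (B * epsCoupling P U j) + ι₂' / (2 * Q') + ι₃ / (4 * Q' ^ 2) + A' * Q' / 4)) /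
              (1 - Φ * (τ * (ι₁ * (B * epsCoupling P U j) + ι₂' / (2 * Q') + ι₃ / (4 * Q' ^ 2) + A' * Q' / 4))))) →
      ∀ Qe : EngConsts, Qtot * imagTimeWeight β M ^ 2 * B * max 1 (Atot / imagTimeWeight β M) ≤ Qe.CE →
      Fintype.card (HubbardFieldIdx L M) ≤ 2 * D + 1 →
      (∀ Ωe : Fin (2 * 3) → Option (SectorLeg (sectorCount j)), levelCount Ωe = 1 →
        klAnisoLegKernelNormAt L M β U μ K klE0 j (2 * 3) Ωe ≤ Qe.CE ^ 3 * (epsCoupling P U j) ^ 2 * (2 : ℝ) ^ ((4 : ℤ) * j)) →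
      KernelNormsLevels L M P Qe β U μ K j := by
  obtain ⟨C₁, C₂, hC₁, hC₂, hL⟩ := klTowerBLevF_le_law_lev_of_blocks_ZX
  obtain ⟨C₁', C₂', Cinc, Dinc, hC₁', hC₂', hCinc, hDinc, hR⟩ := readoutLevF_le_levelsRHS_of_bornRows
  refine ⟨C₁, C₂, C₁', C₂', Cinc, Dinc, hC₁, hC₂, hC₁', hC₂', hCinc, hDinc, fun R hR2 => ?_⟩
  obtain ⟨c₃, hc₃, U₀, hU₀, hL'⟩ := hL R hR2
  obtain ⟨c₃r, hc₃r, U₀r, hU₀r, hR'⟩ := hR R hR2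
  refine ⟨min c₃ c₃r, lt_min hc₃ hc₃r, min U₀ U₀r, lt_min hU₀ hU₀r, ?_⟩
  intro P c hP hc hc6 hc₃' μ hμ U hU hU9 hU₀' β hβmin hβc K hK L M _ _ hL3 hM3 d Kb D hd hKbN hD cc n j hreg hj hKb1 hKbj hjN
    B hB jw κ hκ hGB αw hαw hrow hcol ρ hρ hθ
    crw ccw hcrw hccw hrow' hcol' nV cF cg Ag Pg hnV hcF hcg hAg hPg ι₂ X hι₂ hX Ab Qb Ab' ι₂' X' hAb hQb hAb' hι₂' hX'
    κb αb crb ccb hκb hαb hcrb hccb κl αl hκl hκκb hααb hGBl hrowl hcoll hrowl' hcoll' hDl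
    W Z σ Φ ψ τ ι₁ hW hZ hσ hΦ hψ hτ hι₁ ρk Q' Q κA Yb Y A A' ι₃ hρk hQ' hQ hκA hYb hY hA hA' hι₃ hblock hBle himp₁ himp₂ hcell hUdoor hcdoor
    hinc Aro Qro Qtot Atot hAro hQro hQtot hAtot Qe hCE hcard hsix
  -- (0) the law with its exports on the blocks up to `Kb` («(ℓ)-Z-THREAD» + «(ℓ)-CHERNOFF-EXPORT»)
  obtain ⟨_, hlaw, hcher, hsmall⟩ := hL' P c hP hc hc6 (hc₃'.trans (min_le_left _ _)) μ hμ U hU hU9 (hU₀'.trans (min_le_left _ _)) β hβmin hβc K hK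
    L M hL3 hM3 d Kb D hd hKbN hD cc n j hreg hj B hB jw κ hκ hGB αw hαw hrow hcol ρ hρ hθ crw ccw hcrw hccw hrow' hcol' nV cF cg Ag Pg hnV hcF hcg hAg hPg
    ι₂ X hι₂ hX Ab Qb Ab' ι₂' X' hAb hQb hAb' hι₂' hX' κb αb crb ccb hκb hαb hcrb hccb κl αl hκl hκκb hααb hGBl hrowl hcoll hrowl' hcoll' hDl
    W Z σ Φ ψ τ ι₁ hW hZ hσ hΦ hψ hτ hι₁ ρk Q' Q κA Yb Y A A' ι₃ hρk hQ' hQ hκA hYb hY hA hA' hι₃ hblock hBle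
    (fun k hk1 hk => himp₁ k hk1 hk.le) (fun k hk1 hk => himp₂ k hk1 hk.le) hcell hUdoor hcdoor
  -- (1) the base datum at `F_{d−1}` from p3's weighted grid step, exactly as the assembly builds it
  have hβ : 0 < β := KLRegimeSplit.pos_of_klBetaMin_le hβmin
  have hε : 0 ≤ imagTimeWeight β M := imagTimeWeight_nonneg hβ.le M
  have he : 0 < Real.exp 1 := Real.exp_pos 1
  have hMpos : (0 : ℝ) < (2 * (2 * M) : ℕ) := by
    have := NeZero.ne M
    exact_mod_cast (by omega : 0 < 2 * (2 * M))
  -- the profile norm, the budget and its bi-graded reading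
  have hθ' : Real.exp 1 * αw * nV / κ ^ 2 < 1 := by rw [hnV]; exact hθ
  have hnV0 : 0 ≤ nV := by
    rw [hnV]
    refine normV_nonneg hκ.le hρ.le (fun m' => ?_)
    split_ifs
    · exact mul_nonneg (by positivity) (sum_nonneg fun z _ => mul_nonneg (norm_nonneg _)
        (add_nonneg zero_le_one (by unfold torusSiteDist; exact Nat.cast_nonneg _)))
    · positivity
    · exact le_rfl
  set f : ℝ := (Real.exp 2 * (κ + ρ)) ^ (2 * 2) * (|U| * |β| / (2 * (2 * M) : ℕ)) with hfdef
  have hf0 : 0 ≤ f := by positivity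
  have hcF0 : 0 < cF := by rw [hcF]; have := abs_pos.2 hβ.ne'; positivity
  have hfu : f = cF * |U| := by rw [hfdef, hcF]; ring
  -- p3's literal degree budget (0 in odd degrees / degree 0)
  have h1θ : 0 < 1 - Real.exp 1 * αw * nV / κ ^ 2 := sub_pos.2 hθ'
  obtain ⟨Nlit, hNlit⟩ : ∃ Nlit : ℕ → ℝ, Nlit = fun m =>
      if m = 2 then imagTimeWeight β M ^ (2 - 1) * (crw * ccw ^ (2 - 1) * (ρ⁻¹ ^ 2 * (Real.exp 1 * nV) / (1 - Real.exp 1 * αw * nV / κ ^ 2)))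
      else if Even m ∧ 4 ≤ m then
        imagTimeWeight β M ^ (2 * (m / 2) - 1) * (crw * ccw ^ (2 * (m / 2) - 1) *
          (ρ⁻¹ ^ (2 * (m / 2)) * (Real.exp 1 * f) * (Real.exp 1 * αw * f / κ ^ 2) ^ (m / 2 - 2) / (1 - Real.exp 1 * αw * nV / κ ^ 2) ^ (m / 2)))
      else 0 := ⟨_, rfl⟩
  have hNlit_two : Nlit 2 = imagTimeWeight β M ^ (2 - 1) * (crw * ccw ^ (2 - 1) * (ρ⁻¹ ^ 2 * (Real.exp 1 * nV) / (1 - Real.exp 1 * αw * nV / κ ^ 2))) := by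
    rw [hNlit]; simp
  have hNlit_mul : ∀ p, 2 ≤ p → Nlit (2 * p) = imagTimeWeight β M ^ (2 * p - 1) * (crw * ccw ^ (2 * p - 1) *
      (ρ⁻¹ ^ (2 * p) * (Real.exp 1 * f) * (Real.exp 1 * αw * f / κ ^ 2) ^ (p - 2) / (1 - Real.exp 1 * αw * nV / κ ^ 2) ^ p)) := by
    intro p hp
    have h2 : 2 * p ≠ 2 := by omega
    have hev : Even (2 * p) ∧ 4 ≤ 2 * p := ⟨even_two_mul p, by omega⟩
    rw [hNlit]
    simp only [h2, if_false, hev, and_self, if_true, Nat.mul_div_cancel_left p two_pos]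
  have hNlit0 : ∀ m, 0 ≤ Nlit m := by
    intro m
    rw [hNlit]
    dsimp only
    split_ifs
    · positivity
    · positivity
    · exact le_rfl
  set Nw : ℕ → ℝ := fun p => Nlit (2 * p) with hNwdef
  have hNw0 : ∀ p, 0 ≤ Nw p := fun p => hNlit0 _
  -- p3's step: every weighted pinned sum of `𝒱_d` at `F_{d−1}` is within the budget
  have hp3 := klWtPinnedSumAt_klEffectiveAction_fam_le_of_wgridStep hβ U μ K d (d - 1) jw hκ hGB hαw hrow hcol hρ hθ hccw.le hrow' hcol'
    Nlit (fun m _ => hNlit0 m) (by rw [hNlit_two, hnV]) (fun p hp => by rw [hNlit_mul p hp, hnV])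
  have hgrid : ∀ p, 1 ≤ p → ∀ (q : Fin (2 * p)) (w : SpaceTimeIdx L M × SectorLeg (sectorCount (d - 1))),
      klWtPinnedSumAt L M β μ K (d - 1) jw (2 * p) (klTowerInput L M β U μ K d 1) q w ≤ Nw p := by
    intro p _ q w
    unfold klTowerInput
    rw [Nat.mul_one]
    exact hp3 (2 * p) q w
  have hAg0 : 0 < Ag := by
    have hcg0 : 0 < cg := by rw [hcg]; positivity
    rw [hAg]; positivity
  have hPg0 : 0 ≤ Pg := by
    have hcg0 : 0 < cg := by rw [hcg]; positivity
    have h1θ : 0 < 1 - Real.exp 1 * αw * nV / κ ^ 2 := sub_pos.2 hθ'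
    rw [hPg]; positivity
  have hbi : ∀ p, 3 ≤ p → Nw p ≤ imagTimeWeight β M ^ (2 * p - 1) * Ag * Pg ^ p * |U| ^ (p - 1) := by
    intro p hp
    have h := wgridBudget_bigraded_le (crw := crw) (θ := Real.exp 1 * αw * nV / κ ^ 2) hccw.le hρ hκ hαw hθ' hcF0 hfu (by omega : 2 ≤ p)
    rw [← hcg, ← hAg, ← hPg] at h
    calc Nw p = Nlit (2 * p) := rfl
      _ = imagTimeWeight β M ^ (2 * p - 1) * (crw * ccw ^ (2 * p - 1) *
          (ρ⁻¹ ^ (2 * p) * (Real.exp 1 * f) * (Real.exp 1 * αw * f / κ ^ 2) ^ (p - 2) / (1 - Real.exp 1 * αw * nV / κ ^ 2) ^ p)) :=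
          hNlit_mul p (by omega)
      _ ≤ imagTimeWeight β M ^ (2 * p - 1) * (Ag * Pg ^ p * |U| ^ (p - 1)) := mul_le_mul_of_nonneg_left h (pow_nonneg hε _)
      _ = imagTimeWeight β M ^ (2 * p - 1) * Ag * Pg ^ p * |U| ^ (p - 1) := by ring
  have hK1 : 1 ≤ P.Klam := hP.1
  have hK0 : 0 < P.Klam := lt_of_lt_of_le one_pos hK1
  have hB0 : 0 < B := lt_of_lt_of_le one_pos hB
  have hBK : 1 ≤ B * P.Klam := one_le_mul_of_one_le_of_one_le hB hK1
  have hle : B * P.Klam * |U| ≤ B * epsCoupling P U j := by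
    unfold epsCoupling
    have h1 : |U| ≤ |U| + U ^ 2 * (j : ℝ) := le_add_of_nonneg_right (by positivity)
    calc B * P.Klam * |U| = B * (P.Klam * |U|) := by ring
      _ ≤ B * (P.Klam * (|U| + U ^ 2 * (j : ℝ))) := mul_le_mul_of_nonneg_left (mul_le_mul_of_nonneg_left h1 hK0.le) hB0.le
  have hAb0 : 0 < Ab := by rw [hAb]; positivity
  have hQb0 : 0 ≤ Qb := by rw [hQb]; positivity
  obtain ⟨hNb0, hcar, hlawb⟩ := baseRowsF_of_wgrid_bigraded hβ U μ K d jw Nw hNw0 hgrid hAg0.le hPg0 hbi hK0 hBK hle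
  have hlawb' : ∀ (t : Fin 5) (p : ℕ), 3 ≤ p → (fun (_ : Fin 5) (p : ℕ) => Nw p) t p / klLevUnitF β M t p (d - 1) ≤
      Ab' * (B * epsCoupling P U j) ^ (p - 1) * Qb ^ p := by
    intro t p hp
    rw [hAb', hAb, hQb]
    exact hlawb t p hp
  -- (2) signs of the law's names
  have hM0 : (0 : ℝ) < M := Nat.cast_pos.2 (Nat.pos_of_ne_zero (NeZero.ne M))
  have hεpos : 0 < imagTimeWeight β M := by unfold imagTimeWeight; positivity
  have hWpos : 0 < W := by rw [hW]; positivity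
  have hZpos : 0 < Z := by rw [hZ]; positivity
  have hσnn : 0 ≤ σ := by rw [hσ]; positivity
  have hΦnn : 0 ≤ Φ := by rw [hΦ]; positivity
  have hψnn : 0 ≤ ψ := by rw [hψ]; positivity
  have hτpos : 0 < τ := by rw [hτ]; positivity
  have hQ'0 : 0 < Q' := by rw [hQ']; positivity
  have hρk0 : 0 < ρk := by rw [hρk]; exact lt_max_of_lt_left (by norm_num)
  have hQ0 : 0 ≤ Q := by rw [hQ]; positivity
  have hκA0 : 0 < κA := by rw [hκA]; positivity
  have hAb'0 : 0 ≤ Ab' := by rw [hAb']; positivity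
  have hι₂'0 : 0 ≤ ι₂' := by rw [hι₂']; positivity
  have hX'0 : 0 ≤ X' := by rw [hX']; positivity
  have hY0 : 0 ≤ Y := by rw [hY]; positivity
  have h2inv : 0 < 1 - ((2 : ℝ) ^ d)⁻¹ := sub_pos.2 (inv_lt_one_of_one_lt₀ (one_lt_pow₀ (by norm_num) (by omega)))
  have hA0 : 0 ≤ A := by rw [hA]; exact div_nonneg (mul_nonneg (mul_nonneg zero_le_two hY0) h2inv.le) (mul_pos hκA0 hQ'0).le
  have hA'0 : 0 ≤ A' := by rw [hA']; positivity
  -- (3) the floor read-out on every track (RO-1 + E1 part 7 + units, k3c3-p2's RO-4)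
  have hro := hR' P c hP hc hc6 (hc₃'.trans (min_le_right _ _)) μ hμ U hU hU9 (hU₀'.trans (min_le_right _ _)) β hβmin hβc K hK L M hL3 hM3
    d Kb j D hd hKb1 hKbj hjN hD A B Q Ab' Qb hA0 hB hQ0 hAb'0 hQb0 (fun (_ : Fin 5) (p : ℕ) => Nw p) hNb0 hcar hlawb' hlaw
    W Z σ Φ ψ τ A' Q' ι₁ ι₂' ι₃ hWpos hZpos hσnn hΦnn hψnn hτpos hA'0 hQ'0 (hcher Kb hKb1 le_rfl).1 ((hcher Kb hKb1 le_rfl).2 hD)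
    (himp₁ Kb hKb1 le_rfl) (himp₂ Kb hKb1 le_rfl) hsmall.1 hsmall.2.1 hsmall.2.2.1 hsmall.2.2.2.1 hsmall.2.2.2.2 hinc Aro Qro Qtot Atot hAro hQro hQtot hAtot
    Qe.CE hCE
  -- (4) close on the floor tracks `t = 0, 2, 4` + the six-leg cell, capped at `D` («(ℓ)-RO5-FLOOR-TRACKS»)
  have hQtot0 : 0 ≤ Qtot := by rw [hQtot]; exact mul_nonneg (zero_le_one.trans hDinc) (le_max_of_le_left zero_le_one)
  have hCE0 : 0 ≤ Qe.CE := le_trans (mul_nonneg (by positivity) (le_max_of_le_left zero_le_one)) hCE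
  exact kernelNormsLevels_of_floorTracks hβ.le hCE0 hK0.le hD hcard
    (fun t _ p hp hpD hpt Ωe hc => by rw [← klLevNormOf_klEffectiveAction]; exact hro t p hp hpD hpt Ωe hc) hsix

end Summit.HubbardSuperconductivity.HubbardSuperconductivity.Theorems.EngineV8

end
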